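import Mathlib
import HarnessLib
import Literature.Geometry.Lorentzian.Stationary
import Summits.FinalStateConjecture.FinalStateConjecture.Theorems.ZeroEnergyKerrOrBombNonTrappingHawkingRigidityStubSlabPatchingKillingUC

/-!
# Consistency of Killing continuations on saturated boxes (crux `NonTrappingHawkingRigidity`,
# stmt-FinalStateConjecture-13896, line `Sketch`, stub S3 helper)

Differential-topology helper for the slab patching (stub S3 `stub_slabPatching`). Two local
Killing fields `K₁`, `K₂` on open sets `W₁`, `W₂` which both agree with a given field `L` on the
strict sub-level side `{f < c}` of their domains, AGREE ON `W₁ ∩ W₂` as soon as `W₁`, `W₂` are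
`Y`-saturated boxes over the level `c` (every point above the level is joined inside the box to a
point below the level by an integral curve of the `C¹` field `Y`): by uniqueness of integral
curves (`isMIntegralCurveOn_Ioo_eqOn_of_contMDiffAt`, a local-regularity form of Mathlib's
`isMIntegralCurveOn_Ioo_eqOn_of_contMDiff`) the two descending curves from a common point
coincide, so the connected component of that point in `W₁ ∩ W₂` meets `{f < c}`, where
`K₁ - K₂` vanishes; the difference being a local Killing field, it vanishes on the whole component
by unique continuation (`killing_eqOn_zero_of_isPreconnected`,
`…StubSlabPatchingKillingUC`). Everything is proved; no definitions.
-/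

noncomputable section

-- D-0017: single-problem summit, `Summit.<S>.<S>.…` by design
set_option linter.dupNamespace false

namespace Summit.FinalStateConjecture.FinalStateConjecture.Theorems.NonTrappingHawkingRigidity.AzimuthalPartialAnalyticity.SlabPatching

open Set Filter Function Bundle Literature.Geometry.Lorentzian
open scoped Manifold ContDiff Topology

variable {E : Type*} [NormedAddCommGroup E] [NormedSpace ℝ E] [CompleteSpace E]
  {M : Type*} [TopologicalSpace M] [ChartedSpace E M] [IsManifold 𝓘(ℝ, E) ∞ M]

omit [CompleteSpace E] in
/-- **Integral curves are unique on open intervals, local regularity form**: Mathlib's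
`isMIntegralCurveOn_Ioo_eqOn_of_contMDiff` with the global `C¹` hypothesis on the field replaced by
`C¹`-regularity at the points of one of the curves (same proof: the set where the curves agree is
clopen in the interval, openness by the local uniqueness
`isMIntegralCurveAt_eventuallyEq_of_contMDiffAt`). Lee 2012, Thm. 9.12 (a). [folklore] -/
theorem isMIntegralCurveOn_Ioo_eqOn_of_contMDiffAt [T2Space M] {γ γ' : ℝ → M}
    {v : Π x : M, TangentSpace 𝓘(ℝ, E) x} {a b t₀ : ℝ} (ht₀ : t₀ ∈ Ioo a b)
    (hv : ∀ t ∈ Ioo a b, ContMDiffAt 𝓘(ℝ, E) (𝓘(ℝ, E).prod 𝓘(ℝ, E)) 1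
      (fun x ↦ (TotalSpace.mk' E x (v x) : TangentBundle 𝓘(ℝ, E) M)) (γ t))
    (hγ : IsMIntegralCurveOn γ v (Ioo a b)) (hγ' : IsMIntegralCurveOn γ' v (Ioo a b))
    (h : γ t₀ = γ' t₀) : EqOn γ γ' (Ioo a b) := by
  set s := {t | γ t = γ' t} ∩ Ioo a b with hs
  suffices hsub : Ioo a b ⊆ s from fun t ht ↦ mem_setOf.mp ((subset_def ▸ hsub) t ht).1
  apply isPreconnected_Ioo.subset_of_closure_inter_subset (s := Ioo a b) (u := s) _
    ⟨t₀, ⟨ht₀, ⟨h, ht₀⟩⟩⟩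
  · rw [hs, inter_comm, ← Subtype.image_preimage_val, inter_comm, ← Subtype.image_preimage_val,
      image_subset_image_iff Subtype.val_injective, preimage_setOf_eq]
    intro t ht
    rw [mem_preimage, ← closure_subtype] at ht
    revert ht t
    apply IsClosed.closure_subset (isClosed_eq _ _)
    · rw [continuous_iff_continuousAt]
      rintro ⟨_, ht⟩
      apply ContinuousAt.comp _ continuousAt_subtype_val
      rw [Subtype.coe_mk]
      exact hγ.continuousWithinAt ht |>.continuousAt (Ioo_mem_nhds ht.1 ht.2)
    · rw [continuous_iff_continuousAt]
      rintro ⟨_, ht⟩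
      apply ContinuousAt.comp _ continuousAt_subtype_val
      rw [Subtype.coe_mk]
      exact hγ'.continuousWithinAt ht |>.continuousAt (Ioo_mem_nhds ht.1 ht.2)
  · rw [isOpen_iff_mem_nhds]
    intro t₁ ht₁
    have hmem := Ioo_mem_nhds ht₁.2.1 ht₁.2.2
    have heq : γ =ᶠ[𝓝 t₁] γ' := isMIntegralCurveAt_eventuallyEq_of_contMDiffAt
      BoundarylessManifold.isInteriorPoint (hv _ ht₁.2) (hγ.isMIntegralCurveAt hmem)
      (hγ'.isMIntegralCurveAt hmem) ht₁.1
    apply (heq.and hmem).mono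
    exact fun _ ht ↦ ht

variable [FiniteDimensional ℝ E] [T2Space M] [LocallyConnectedSpace M]
  (g : PseudoRiemannianMetric 𝓘(ℝ, E) ∞ E (TangentSpace 𝓘(ℝ, E) : M → Type _)) [g.HasLeviCivita]

/-- **Consistency of continuations on saturated boxes.** Let `Y` be `C^∞` on an open `O`, `f`
continuous on `O`, and `W₁ ⊆ O`, `W₂` open `Y`-saturated boxes over the level `c` (every `x ∈ Wᵢ`
with `c ≤ f x` is `γ 0` for an integral curve `γ` of `Y` on an open interval `(a', b') ∋ 0`
staying in `Wᵢ`, with `f (γ a) < c` for some `a' < a < 0`). If `Kᵢ` is `C^∞` and satisfies the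
Killing equation on `Wᵢ` and agrees with `L` on `Wᵢ ∩ {f < c}` (`i = 1, 2`), then `K₁ = K₂` on
`W₁ ∩ W₂`: the descending curves from `x ∈ W₁ ∩ W₂` coincide (uniqueness of integral curves), so
the connected component of `x` in `W₁ ∩ W₂` meets `{f < c}`, where `K₁ - K₂ = 0`, and `K₁ - K₂` is a
local Killing field on that component (unique continuation, O'Neill 1983, Ch. 9, Lemma 9.28).
[cite: ONeill1983, Ch. 9, Lemma 9.28] -/
theorem eqOn_of_saturated {O W₁ W₂ : Set M} {f : M → ℝ} {c : ℝ}
    {Y L K₁ K₂ : Π x : M, TangentSpace 𝓘(ℝ, E) x} (hO : IsOpen O) (hfO : ContinuousOn f O)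
    (hY : ContMDiffOn 𝓘(ℝ, E) (𝓘(ℝ, E).prod 𝓘(ℝ, E)) ∞
      (fun x ↦ (TotalSpace.mk' E x (Y x) : TangentBundle 𝓘(ℝ, E) M)) O)
    (hW₁ : IsOpen W₁) (hW₂ : IsOpen W₂) (h₁O : W₁ ⊆ O)
    (hS₁ : ∀ x ∈ W₁, c ≤ f x → ∃ (γ : ℝ → M) (a a' b' : ℝ), a' < a ∧ a < 0 ∧ 0 < b' ∧ γ 0 = x ∧
      IsMIntegralCurveOn γ Y (Ioo a' b') ∧ (∀ t ∈ Ioo a' b', γ t ∈ W₁) ∧ f (γ a) < c)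
    (hS₂ : ∀ x ∈ W₂, c ≤ f x → ∃ (γ : ℝ → M) (a a' b' : ℝ), a' < a ∧ a < 0 ∧ 0 < b' ∧ γ 0 = x ∧
      IsMIntegralCurveOn γ Y (Ioo a' b') ∧ (∀ t ∈ Ioo a' b', γ t ∈ W₂) ∧ f (γ a) < c)
    (hK₁s : ContMDiffOn 𝓘(ℝ, E) (𝓘(ℝ, E).prod 𝓘(ℝ, E)) ∞
      (fun x ↦ (TotalSpace.mk' E x (K₁ x) : TangentBundle 𝓘(ℝ, E) M)) W₁)
    (hK₁k : ∀ x ∈ W₁, ∀ v w : TangentSpace 𝓘(ℝ, E) x,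
      g.val x (g.leviCivita K₁ x v) w + g.val x v (g.leviCivita K₁ x w) = 0)
    (hK₁L : ∀ x ∈ W₁, f x < c → K₁ x = L x)
    (hK₂s : ContMDiffOn 𝓘(ℝ, E) (𝓘(ℝ, E).prod 𝓘(ℝ, E)) ∞
      (fun x ↦ (TotalSpace.mk' E x (K₂ x) : TangentBundle 𝓘(ℝ, E) M)) W₂)
    (hK₂k : ∀ x ∈ W₂, ∀ v w : TangentSpace 𝓘(ℝ, E) x,
      g.val x (g.leviCivita K₂ x v) w + g.val x v (g.leviCivita K₂ x w) = 0)
    (hK₂L : ∀ x ∈ W₂, f x < c → K₂ x = L x) :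
    ∀ x ∈ W₁ ∩ W₂, K₁ x = K₂ x := by
  intro x hx
  by_cases hcx : f x < c
  · rw [hK₁L x hx.1 hcx, hK₂L x hx.2 hcx]
  push Not at hcx
  -- a point `y` below the level in the connected component of `x` in `W₁ ∩ W₂`
  obtain ⟨y, hyC, hfy⟩ : ∃ y ∈ connectedComponentIn (W₁ ∩ W₂) x, f y < c := by
    obtain ⟨γ₁, a₁, a₁', b₁', ha₁', ha₁, hb₁', hγ₁0, hγ₁, hγ₁W, hf₁⟩ := hS₁ x hx.1 hcx
    obtain ⟨γ₂, a₂, a₂', b₂', ha₂', ha₂, hb₂', hγ₂0, hγ₂, hγ₂W, hf₂⟩ := hS₂ x hx.2 hcx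
    -- the two curves agree on the common open interval
    set α := max a₁' a₂' with hα
    set β := min b₁' b₂' with hβ
    have hI₁ : Ioo α β ⊆ Ioo a₁' b₁' := Ioo_subset_Ioo (le_max_left _ _) (min_le_left _ _)
    have hI₂ : Ioo α β ⊆ Ioo a₂' b₂' := Ioo_subset_Ioo (le_max_right _ _) (min_le_right _ _)
    have h0 : (0 : ℝ) ∈ Ioo α β := ⟨max_lt (by linarith) (by linarith), lt_min hb₁' hb₂'⟩
    have hv : ∀ t ∈ Ioo α β, ContMDiffAt 𝓘(ℝ, E) (𝓘(ℝ, E).prod 𝓘(ℝ, E)) 1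
        (fun x ↦ (TotalSpace.mk' E x (Y x) : TangentBundle 𝓘(ℝ, E) M)) (γ₁ t) := by
      intro t ht
      have hm : γ₁ t ∈ O := h₁O (hγ₁W t (hI₁ ht))
      exact ((hY _ hm).contMDiffAt (hO.mem_nhds hm)).of_le (by exact_mod_cast le_top)
    have heq : EqOn γ₁ γ₂ (Ioo α β) := isMIntegralCurveOn_Ioo_eqOn_of_contMDiffAt h0 hv
      (hγ₁.mono hI₁) (hγ₂.mono hI₂) (by rw [hγ₁0, hγ₂0])
    -- the parameter `a = max a₁ a₂` of a point below the level on the common curve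
    set a := max a₁ a₂ with ha
    have haI : a ∈ Ioo α β :=
      ⟨max_lt_iff.2 ⟨lt_of_lt_of_le ha₁' (le_max_left _ _), lt_of_lt_of_le ha₂' (le_max_right _ _)⟩,
        lt_of_lt_of_le (max_lt ha₁ ha₂) (le_of_lt (lt_min hb₁' hb₂'))⟩
    have hfa : f (γ₁ a) < c := by
      rcases le_total a₁ a₂ with h12 | h21
      · have : a = a₂ := max_eq_right h12
        rw [this, heq (this ▸ haI)]
        exact hf₂
      · have : a = a₁ := max_eq_left h21
        rw [this]
        exact hf₁
    -- the arc `γ₁ [a, 0]` lies in `W₁ ∩ W₂` and is connected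
    have harc : γ₁ '' Icc a 0 ⊆ W₁ ∩ W₂ := by
      rintro _ ⟨t, ht, rfl⟩
      have htI : t ∈ Ioo α β := ⟨lt_of_lt_of_le haI.1 ht.1, lt_of_le_of_lt ht.2 h0.2⟩
      exact ⟨hγ₁W t (hI₁ htI), heq htI ▸ hγ₂W t (hI₂ htI)⟩
    have hcont : ContinuousOn γ₁ (Icc a 0) := fun t ht ↦
      (hγ₁.continuousWithinAt (hI₁ ⟨lt_of_lt_of_le haI.1 ht.1, lt_of_le_of_lt ht.2 h0.2⟩)).mono
        fun u hu ↦ hI₁ ⟨lt_of_lt_of_le haI.1 hu.1, lt_of_le_of_lt hu.2 h0.2⟩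
    have hpre : IsPreconnected (γ₁ '' Icc a 0) := isPreconnected_Icc.image γ₁ hcont
    have hxarc : x ∈ γ₁ '' Icc a 0 := ⟨0, ⟨le_of_lt (max_lt ha₁ ha₂), le_rfl⟩, hγ₁0⟩
    have hsub := hpre.subset_connectedComponentIn hxarc harc
    exact ⟨γ₁ a, hsub ⟨a, ⟨le_rfl, le_of_lt (max_lt ha₁ ha₂)⟩, rfl⟩, hfa⟩
  -- unique continuation of `K₁ - K₂` on the component
  set C := connectedComponentIn (W₁ ∩ W₂) x with hC
  have hCo : IsOpen C := (hW₁.inter hW₂).connectedComponentIn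
  have hCc : IsPreconnected C := isPreconnected_connectedComponentIn
  have hCW : C ⊆ W₁ ∩ W₂ := connectedComponentIn_subset _ _
  have hxC : x ∈ C := mem_connectedComponentIn hx
  have hZs : ContMDiffOn 𝓘(ℝ, E) (𝓘(ℝ, E).prod 𝓘(ℝ, E)) ∞
      (fun x ↦ (TotalSpace.mk' E x ((K₁ - K₂) x) : TangentBundle 𝓘(ℝ, E) M)) C :=
    (hK₁s.mono fun z hz ↦ (hCW hz).1).sub_section (hK₂s.mono fun z hz ↦ (hCW hz).2)
  have hZk : ∀ z ∈ C, ∀ v w : TangentSpace 𝓘(ℝ, E) z,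
      g.val z (g.leviCivita (K₁ - K₂) z v) w + g.val z v (g.leviCivita (K₁ - K₂) z w) = 0 := by
    intro z hz v w
    have hz' := hCW hz
    have hd₁ : MDiffAt (T% K₁) z :=
      ((hK₁s z hz'.1).contMDiffAt (hW₁.mem_nhds hz'.1)).mdifferentiableAt (by simp)
    have hd₂ : MDiffAt (T% K₂) z :=
      ((hK₂s z hz'.2).contMDiffAt (hW₂.mem_nhds hz'.2)).mdifferentiableAt (by simp)
    rw [g.leviCivita.apply_sub_section hd₁ hd₂]
    have h1 := hK₁k z hz'.1 v w
    have h2 := hK₂k z hz'.2 v w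
    rw [_root_.sub_apply, _root_.sub_apply, map_sub, map_sub, _root_.sub_apply]
    linarith
  set O' : Set M := C ∩ (O ∩ f ⁻¹' Iio c) with hO'
  have hO'o : IsOpen O' := hCo.inter (hfO.isOpen_inter_preimage hO isOpen_Iio)
  have hO'C : O' ⊆ C := inter_subset_left
  have hO'ne : O'.Nonempty := ⟨y, hyC, h₁O (hCW hyC).1, hfy⟩
  have hZO' : ∀ z ∈ O', (K₁ - K₂) z = 0 := by
    rintro z ⟨hzC, -, hfz⟩
    have hz' := hCW hzC
    show K₁ z - K₂ z = 0
    rw [hK₁L z hz'.1 hfz, hK₂L z hz'.2 hfz, sub_self]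
  have h := killing_eqOn_zero_of_isPreconnected g hCo hCc hZs hZk hO'o hO'C hO'ne hZO' x hxC
  exact sub_eq_zero.1 h

/-- **Registered form (sub-goal `stub_slabPatching_consistency` of stub S3 `stub_slabPatching`):
consistency of continuations on saturated boxes** on the carrier of a stationary black hole
(`eqOn_of_saturated`; the carrier is locally connected, being locally Euclidean).
[cite: ONeill1983, Ch. 9, Lemma 9.28] -/
theorem stub_slabPatching_consistency :
    ∀ (𝓑 : StationaryAFBlackHole.{0}) [𝓑.metric.HasLeviCivita],
      ∀ (O W₁ W₂ : Set 𝓑.carrier) (f : 𝓑.carrier → ℝ) (c : ℝ)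
        (Y L K₁ K₂ : Π x : 𝓑.carrier, TangentSpace (𝓡 4) x),
      IsOpen O → ContinuousOn f O →
      ContMDiffOn (𝓡 4) ((𝓡 4).prod 𝓘(ℝ, E4)) ((⊤ : ℕ∞) : WithTop ℕ∞)
        (fun x ↦ (Bundle.TotalSpace.mk' E4 x (Y x) : TangentBundle (𝓡 4) 𝓑.carrier)) O →
      IsOpen W₁ → IsOpen W₂ → W₁ ⊆ O →
      (∀ x ∈ W₁, c ≤ f x → ∃ (γ : ℝ → 𝓑.carrier) (a a' b' : ℝ), a' < a ∧ a < 0 ∧ 0 < b' ∧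
        γ 0 = x ∧ IsMIntegralCurveOn γ Y (Set.Ioo a' b') ∧ (∀ t ∈ Set.Ioo a' b', γ t ∈ W₁) ∧
        f (γ a) < c) →
      (∀ x ∈ W₂, c ≤ f x → ∃ (γ : ℝ → 𝓑.carrier) (a a' b' : ℝ), a' < a ∧ a < 0 ∧ 0 < b' ∧
        γ 0 = x ∧ IsMIntegralCurveOn γ Y (Set.Ioo a' b') ∧ (∀ t ∈ Set.Ioo a' b', γ t ∈ W₂) ∧
        f (γ a) < c) →
      ContMDiffOn (𝓡 4) ((𝓡 4).prod 𝓘(ℝ, E4)) ((⊤ : ℕ∞) : WithTop ℕ∞)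
        (fun x ↦ (Bundle.TotalSpace.mk' E4 x (K₁ x) : TangentBundle (𝓡 4) 𝓑.carrier)) W₁ →
      (∀ x ∈ W₁, ∀ v w : TangentSpace (𝓡 4) x,
        𝓑.metric.val x (𝓑.metric.leviCivita K₁ x v) w +
          𝓑.metric.val x v (𝓑.metric.leviCivita K₁ x w) = 0) →
      (∀ x ∈ W₁, f x < c → K₁ x = L x) →
      ContMDiffOn (𝓡 4) ((𝓡 4).prod 𝓘(ℝ, E4)) ((⊤ : ℕ∞) : WithTop ℕ∞)
        (fun x ↦ (Bundle.TotalSpace.mk' E4 x (K₂ x) : TangentBundle (𝓡 4) 𝓑.carrier)) W₂ →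
      (∀ x ∈ W₂, ∀ v w : TangentSpace (𝓡 4) x,
        𝓑.metric.val x (𝓑.metric.leviCivita K₂ x v) w +
          𝓑.metric.val x v (𝓑.metric.leviCivita K₂ x w) = 0) →
      (∀ x ∈ W₂, f x < c → K₂ x = L x) →
      ∀ x ∈ W₁ ∩ W₂, K₁ x = K₂ x := by
  intro 𝓑 _ O W₁ W₂ f c Y L K₁ K₂ hO hfO hY hW₁ hW₂ h₁O hS₁ hS₂ hK₁s hK₁k hK₁L hK₂s hK₂k hK₂L
  haveI : LocallyConnectedSpace 𝓑.carrier := ChartedSpace.locallyConnectedSpace E4 𝓑.carrier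
  exact eqOn_of_saturated 𝓑.metric.toPseudoRiemannianMetric hO hfO hY hW₁ hW₂ h₁O hS₁ hS₂ hK₁s
    hK₁k hK₁L hK₂s hK₂k hK₂L

end Summit.FinalStateConjecture.FinalStateConjecture.Theorems.NonTrappingHawkingRigidity.AzimuthalPartialAnalyticity.SlabPatching

end
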